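import Literature.NumberTheory.PAdicHodge.TateLogCyclotomicClass
import Mathlib.Topology.MetricSpace.Antilipschitz
import HarnessLib

/-!
# Tate's twisted coboundary theorem on `X = \widehat{K_∞}`: `γ − c` is bijective for `c ≠ 1` near `1`

Continuation of `TateInvariantsBase` (the `H⁰` eigenvector lemma) and `TateLogCyclotomicClass` (`R_n`
additive). Notation as there: `F` a non-archimedean local field of characteristic `0` and residue
characteristic `p`, `K₀ = PadicBase F p hp ≅ ℚ_p`, `F̄ = NormedAlgClosure F`, `ℂ_F = CompletedAlgClosure F`,
`G₀ = Gal(F̄/K₀)`, `χ : G₀ → ℤ_pˣ` the cyclotomic character, `K M = K₀(ζ_{p^M})`, `K_∞ = ⋃ K M`,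
`S ⊆ ℂ_F` its image, `X = \widehat{K_∞}` its closure, `R_n = TateTrace.Rhat n : X → ℂ_F` Tate's normalised
trace, `γ = gen n`, `ι : K₀ → ℂ_F`.

**Theorem** (Tate 1967, §3.3, proof of Theorem 2; Fontaine–Ouyang Prop. 3.17). Let `n ≥ 2` and `c ∈ K₀`
with `c ≠ 1` and `‖p‖⁻² ‖c − 1‖ < 1`. Then the `K₀`-linear operator `T_c = γ − c` (i.e.
`y ↦ γ • y − ι c · y`) is BIJECTIVE on `X`, with the a-priori bound
`‖y‖ ≤ C · ‖γ y − c y‖`, `C = (‖p‖⁻² + ‖p‖⁻¹/‖c−1‖)/(1 − ‖p‖⁻²‖c−1‖)`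
(`TateTrace.norm_le_mul_norm_gen_smul_sub_mul`, `TateTrace.exists_unique_gen_smul_sub_mul_eq`). For
`c = χ(γ)^{-j}`, `j ≠ 0`, `n ≥ 3` this says (`TateTrace.exists_unique_chi_zpow_mul_gen_smul_sub_eq`):

  **every `a ∈ X` is `χ(γ)^j · γ y − y` for a UNIQUE `y ∈ X`** —

`H⁰(⟨γ⟩, X(χ^j)) = 0` (the tree's eigenvector lemma) AND `H¹(⟨γ⟩, X(χ^j)) = 0` at the level of
`X = \widehat{K_∞}`: the `X`-level ("decompleted") input of Tate's `H¹(Γ, ℂ(χ^j)) = 0`, `j ≠ 0`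
(Theorem 2), whose other input — `H¹(Gal(F̄/K_∞), ℂ_F) = 0`, Tate §3.2 Prop. 9–10 — is not in the tree.
In the twisted case no restriction to `ker R_n` is needed (contrast Prop. 7 for `γ − 1`, whose cokernel on
`X` is `K n`).

Proof. A-PRIORI BOUND on `X` (Tate's method): with `t = γy − c y`, `γy − y = t + (c−1)y`, Tate's estimate
`‖y − R_n y‖ ≤ ‖p‖⁻²‖γy − y‖` (tree `norm_sub_Rhat_le`) and `R_n t = (1 − c) R_n y` (`R_n ∘ γ = R_n`,
`K₀`-linearity; so `‖c−1‖‖R_n y‖ ≤ ‖p‖⁻¹‖t‖` by the uniform bound `‖R_n‖ ≤ ‖p‖⁻¹`) give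
`‖y‖ ≤ ‖y − R_n y‖ + ‖R_n y‖ ≤ ‖p‖⁻²(‖t‖ + ‖c−1‖‖y‖) + ‖p‖⁻¹‖t‖/‖c−1‖`. SURJECTIVITY: `T_c` maps each
finite layer `K M` into itself and is injective there (eigenvector lemma), hence bijective (`K M` is
finite-dimensional over `K₀`); so `T_c(X) ⊇ S` is dense, and it is closed because `T_c` is antilipschitz
(the bound) and uniformly continuous on the complete space `X` (Mathlib `AntilipschitzWith.isClosed_range`).
No named facts; nothing cite-only is used.

## References

* J. Tate, *p-divisible groups* (1967), §3.2 Prop. 7–8, §3.3 Theorems 1–2. [Tate1967]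
* J.-M. Fontaine, Y. Ouyang, *Theory of p-adic Galois representations*, §3.1 Prop. 3.16, §3.2 Prop. 3.17,
  Thm. 3.21. [FontaineOuyang2022]
-/

noncomputable section

open ValuativeRel Field UniformSpace Filter Topology Finset

open scoped IntermediateField NNReal

namespace Literature.NumberTheory.PAdicHodge

open Literature.NumberTheory.GaloisRepresentations
open Literature.NumberTheory.GaloisRepresentations.IsNonarchimedeanLocalField
open CyclotomicTower

variable {F : Type} [Field F] [ValuativeRel F] [TopologicalSpace F] [IsNonarchimedeanLocalField F]
  [CharZero F] {p : ℕ} [Fact p.Prime] (hp : valuation F p < 1)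

namespace TateTrace

variable {n : ℕ}

/-! ### `X` is closed under the operators `γ − c` -/

/-- `X = \widehat{K_∞}` is closed under subtraction. [cite: Tate1967, §3.1] -/
theorem sub_mem_X {x a : CompletedAlgClosure F} (hx : x ∈ X hp) (ha : a ∈ X hp) : x - a ∈ X hp :=
  map_mem_closure₂ continuous_sub hx ha fun _ hs _ ht => sub_mem_S hp hs ht

/-- `X` is stable under `T_c : y ↦ γ y − ι c · y`. [cite: Tate1967, §3.3] -/
theorem gen_smul_sub_mul_mem_X (n : ℕ) (c : PadicBase F p hp) {y : CompletedAlgClosure F} (hy : y ∈ X hp) :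
    gen hp n • y - ι hp c * y ∈ X hp :=
  sub_mem_X hp (smul_mem_X hp _ hy) (ι_mul_mem_X hp c hy)

/-- `S` is stable under `T_c`. [cite: Tate1967, §3.3] -/
theorem gen_smul_sub_mul_mem_S (n : ℕ) (c : PadicBase F p hp) {s : CompletedAlgClosure F} (hs : s ∈ S hp) :
    gen hp n • s - ι hp c * s ∈ S hp :=
  sub_mem_S hp (smul_mem_S hp _ hs) (ι_mul_mem_S hp c hs)

/-- `ι c − 1 = ι (c − 1)` and its norm is `‖c − 1‖`. [folklore] -/
private theorem norm_ι_sub_one (c : PadicBase F p hp) : ‖ι hp c - 1‖ = ‖c - 1‖ := by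
  rw [← ιHom_apply, ← map_one (ιHom hp), ← map_sub, ιHom_apply, norm_ι]

/-! ### `R_n` on `X`: subtraction, the uniform bound, and `R_n ∘ T_c = (1 − c) R_n` -/

/-- **`R_n` is subtractive on `X`** (from additivity). [cite: Tate1967, §3.1] -/
theorem Rhat_sub (hn : 2 ≤ n) (x a : X hp) :
    Rhat hp n ⟨(x : CompletedAlgClosure F) - a, sub_mem_X hp x.2 a.2⟩ = Rhat hp n x - Rhat hp n a := by
  have h := Rhat_add hp hn ⟨(x : CompletedAlgClosure F) - a, sub_mem_X hp x.2 a.2⟩ a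
  have hx : (⟨((⟨(x : CompletedAlgClosure F) - a, sub_mem_X hp x.2 a.2⟩ : X hp) : CompletedAlgClosure F) + a,
      add_mem_X hp (sub_mem_X hp x.2 a.2) a.2⟩ : X hp) = x := Subtype.ext (sub_add_cancel _ _)
  rw [hx] at h
  rw [h, add_sub_cancel_right]

/-- **Uniform bound on `X`**: `‖R_n x‖ ≤ ‖p‖⁻¹ ‖x‖` (by density from `S`). [cite: Tate1967, §3.1 Prop. 6] -/
theorem norm_Rhat_le (hn : 2 ≤ n) (x : X hp) :
    ‖Rhat hp n x‖ ≤ ‖(p : PadicBase F p hp)‖⁻¹ * ‖(x : CompletedAlgClosure F)‖ := by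
  refine isClosed_property (denseRange_incl hp)
    (p := fun x : X hp => ‖Rhat hp n x‖ ≤ ‖(p : PadicBase F p hp)‖⁻¹ * ‖(x : CompletedAlgClosure F)‖)
    (isClosed_le (continuous_Rhat hp hn).norm (continuous_const.mul continuous_subtype_val.norm))
    (fun s => ?_) x
  rw [Rhat_incl hp hn]
  exact norm_Rfun_le hp hn s

/-- **`R_n (γ y − c y) = (1 − c) R_n y`** on `X` (`R_n ∘ γ = R_n` and `K₀`-linearity). [cite: Tate1967, §3.2 Prop. 7] -/
theorem Rhat_gen_smul_sub_mul (hn : 2 ≤ n) (c : PadicBase F p hp) (y : X hp) :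
    Rhat hp n ⟨gen hp n • (y : CompletedAlgClosure F) - ι hp c * y, gen_smul_sub_mul_mem_X hp n c y.2⟩ =
      (1 - ι hp c) * Rhat hp n y := by
  have h := Rhat_sub hp hn (genX hp n y) (mulX hp c y)
  have h1 : (⟨((genX hp n y : X hp) : CompletedAlgClosure F) - (mulX hp c y : X hp),
      sub_mem_X hp (genX hp n y).2 (mulX hp c y).2⟩ : X hp) =
      ⟨gen hp n • (y : CompletedAlgClosure F) - ι hp c * y, gen_smul_sub_mul_mem_X hp n c y.2⟩ := rfl
  rw [h1] at h
  rw [h, Rhat_genX hp hn, Rhat_mulX hp hn, sub_mul, one_mul]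

/-! ### The a-priori bound and injectivity -/

/-- **A-priori bound** (Tate): for `n ≥ 2`, `c ∈ K₀` with `c ≠ 1` and `q = ‖p‖⁻²‖c − 1‖ < 1`, every
`y ∈ X` satisfies `‖y‖ ≤ C ‖γ y − c y‖` with `C = (‖p‖⁻² + ‖p‖⁻¹/‖c−1‖)/(1 − q)`. Proof in the module
docstring. [cite: Tate1967, §3.3 (proof of Theorem 2)] [cite: FontaineOuyang2022, §3.2 Prop. 3.17] -/
theorem norm_le_mul_norm_gen_smul_sub_mul (hn : 2 ≤ n) {c : PadicBase F p hp} (hc1 : c ≠ 1)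
    (hsmall : ‖(p : PadicBase F p hp)‖⁻¹ ^ 2 * ‖c - 1‖ < 1) {y : CompletedAlgClosure F} (hy : y ∈ X hp) :
    ‖y‖ ≤ (‖(p : PadicBase F p hp)‖⁻¹ ^ 2 + ‖(p : PadicBase F p hp)‖⁻¹ / ‖c - 1‖) /
        (1 - ‖(p : PadicBase F p hp)‖⁻¹ ^ 2 * ‖c - 1‖) * ‖gen hp n • y - ι hp c * y‖ := by
  set P : ℝ := ‖(p : PadicBase F p hp)‖⁻¹ with hP
  set d : ℝ := ‖c - 1‖ with hd
  set t : CompletedAlgClosure F := gen hp n • y - ι hp c * y with ht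
  have hP0 : 0 < P := inv_pos.mpr (PadicBase.norm_p_pos hp)
  have hd0 : 0 < d := norm_pos_iff.mpr (sub_ne_zero.mpr hc1)
  have hq1 : 0 < 1 - P ^ 2 * d := sub_pos.mpr hsmall
  set y' : X hp := ⟨y, hy⟩ with hy'
  -- (1) `‖γy − y‖ ≤ ‖t‖ + d ‖y‖`
  have h1 : ‖gen hp n • y - y‖ ≤ ‖t‖ + d * ‖y‖ := by
    have heq : gen hp n • y - y = t + (ι hp c - 1) * y := by rw [ht]; ring
    rw [heq]
    refine (norm_add_le _ _).trans ?_
    rw [norm_mul, norm_ι_sub_one]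
  -- (2) Tate's estimate
  have h2 : ‖y - Rhat hp n y'‖ ≤ P ^ 2 * ‖gen hp n • y - y‖ := norm_sub_Rhat_le hp hn y'
  -- (3) `d ‖R y‖ ≤ P ‖t‖`
  have h3 : d * ‖Rhat hp n y'‖ ≤ P * ‖t‖ := by
    have hR := Rhat_gen_smul_sub_mul hp hn c y'
    have hle := norm_Rhat_le hp hn
      ⟨gen hp n • (y' : CompletedAlgClosure F) - ι hp c * y', gen_smul_sub_mul_mem_X hp n c y'.2⟩
    rw [hR, norm_mul, norm_sub_rev, norm_ι_sub_one] at hle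
    exact hle
  have h3' : ‖Rhat hp n y'‖ ≤ P * ‖t‖ / d := by
    rw [le_div_iff₀ hd0, mul_comm]; exact h3
  -- (4) combine
  have h4 : ‖y‖ ≤ ‖y - Rhat hp n y'‖ + ‖Rhat hp n y'‖ := by
    calc ‖y‖ = ‖(y - Rhat hp n y') + Rhat hp n y'‖ := by rw [sub_add_cancel]
      _ ≤ _ := norm_add_le _ _
  have hP2 : 0 ≤ P ^ 2 := sq_nonneg P
  have h5 : ‖y‖ ≤ P ^ 2 * (‖t‖ + d * ‖y‖) + P * ‖t‖ / d :=
    h4.trans (add_le_add (h2.trans (mul_le_mul_of_nonneg_left h1 hP2)) h3')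
  have h6 : ‖y‖ * (1 - P ^ 2 * d) ≤ (P ^ 2 + P / d) * ‖t‖ := by
    have : P ^ 2 * (‖t‖ + d * ‖y‖) + P * ‖t‖ / d = (P ^ 2 + P / d) * ‖t‖ + P ^ 2 * d * ‖y‖ := by
      field_simp
      ring
    rw [this] at h5
    linarith
  rw [← le_div_iff₀ hq1] at h6
  have h7 : (P ^ 2 + P / d) * ‖t‖ / (1 - P ^ 2 * d) = (P ^ 2 + P / d) / (1 - P ^ 2 * d) * ‖t‖ := by ring
  rw [← h7]
  exact h6

/-- **Injectivity of `γ − c` on `X`**: `γ y − c y = γ y' − c y'` with `y, y' ∈ X` forces `y = y'`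
(the tree's eigenvector lemma applied to `y − y'`). [cite: Tate1967, §3.3 (proof of Theorem 2)] -/
theorem eq_of_gen_smul_sub_mul_eq (hn : 2 ≤ n) {c : PadicBase F p hp} (hc1 : c ≠ 1)
    (hsmall : ‖(p : PadicBase F p hp)‖⁻¹ ^ 2 * ‖c - 1‖ < 1) {y y' : CompletedAlgClosure F}
    (hy : y ∈ X hp) (hy' : y' ∈ X hp)
    (h : gen hp n • y - ι hp c * y = gen hp n • y' - ι hp c * y') : y = y' := by
  have h0 : gen hp n • (y - y') = ι hp c * (y - y') := by
    rw [smul_sub, mul_sub]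
    exact sub_eq_sub_iff_sub_eq_sub.mp h
  exact sub_eq_zero.mp (eq_zero_of_gen_smul_eq hp hn (sub_mem_X hp hy hy') hc1 hsmall h0)

/-! ### Surjectivity at finite level -/

/-- **`γ − c` is bijective on each layer `K M`** (`M ≥ n + 1`; `c ≠ 1` close to `1`): for `w ∈ K M` there
is `z ∈ K M` with `γ z − c z = w`. (`γ − c` is a `K₀`-linear endomorphism of the finite-dimensional
`K₀`-space `K M`, injective by the eigenvector lemma, hence surjective.)
[cite: Tate1967, §3.3 (proof of Theorem 2)] [cite: FontaineOuyang2022, §3.2 Prop. 3.17] -/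
theorem exists_mem_K_gen_smul_sub_smul_eq (hn : 2 ≤ n) {M : ℕ} {c : PadicBase F p hp} (hc1 : c ≠ 1)
    (hsmall : ‖(p : PadicBase F p hp)‖⁻¹ ^ 2 * ‖c - 1‖ < 1) {w : NormedAlgClosure F} (hw : w ∈ K hp M) :
    ∃ z ∈ K hp M, gen hp n • z - c • z = w := by
  haveI : FiniteDimensional (PadicBase F p hp) (K hp M) :=
    IntermediateField.adjoin.finiteDimensional (Algebra.IsIntegral.isIntegral (zeta F p M))
  let γL : K hp M →ₗ[PadicBase F p hp] K hp M :=
    { toFun := fun z => ⟨gen hp n • (z : NormedAlgClosure F), smul_mem_K hp _ z.2⟩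
      map_add' := fun z₁ z₂ => Subtype.ext (by
        simp only [IntermediateField.coe_add]; exact smul_add _ _ _)
      map_smul' := fun b z => Subtype.ext (by
        simp only [IntermediateField.coe_smul, RingHom.id_apply]; exact smul_comm _ _ _) }
  let T : K hp M →ₗ[PadicBase F p hp] K hp M := γL - c • LinearMap.id
  have hT : ∀ z : K hp M, ((T z : K hp M) : NormedAlgClosure F) =
      gen hp n • (z : NormedAlgClosure F) - c • (z : NormedAlgClosure F) := fun _ => rfl
  -- injective, by the eigenvector lemma in `ℂ_F`
  have hTinj : Function.Injective T := by
    intro z₁ z₂ h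
    have h1 : T (z₁ - z₂) = 0 := by rw [map_sub, h, sub_self]
    have h2 : gen hp n • ((z₁ - z₂ : K hp M) : NormedAlgClosure F) = c • ((z₁ - z₂ : K hp M) : NormedAlgClosure F) := by
      have := congrArg (fun z : K hp M => (z : NormedAlgClosure F)) h1
      simp only [hT] at this
      exact sub_eq_zero.mp this
    have h3 : gen hp n • (((z₁ - z₂ : K hp M) : NormedAlgClosure F) : CompletedAlgClosure F) =
        ι hp c * (((z₁ - z₂ : K hp M) : NormedAlgClosure F) : CompletedAlgClosure F) := by
      rw [CompletedAlgClosure.base_smul_coe, h2, coe_base_smul]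
    have hX : (((z₁ - z₂ : K hp M) : NormedAlgClosure F) : CompletedAlgClosure F) ∈ X hp :=
      S_subset_X hp (coe_mem_S hp (K_le_Kinf hp M (z₁ - z₂).2))
    have h4 := eq_zero_of_gen_smul_eq hp hn hX hc1 hsmall h3
    have h5 : ((z₁ - z₂ : K hp M) : NormedAlgClosure F) = 0 := Completion.coe_injective _ (by
      rw [h4, Completion.coe_zero])
    exact sub_eq_zero.mp (Subtype.ext h5)
  obtain ⟨z, hz⟩ := LinearMap.surjective_of_injective hTinj ⟨w, hw⟩
  refine ⟨(z : NormedAlgClosure F), z.2, ?_⟩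
  have := congrArg (fun z : K hp M => (z : NormedAlgClosure F)) hz
  simp only [hT] at this
  exact this

/-! ### Surjectivity on `X` -/

/-- **`γ − c` is surjective on `X = \widehat{K_∞}`** (`n ≥ 2`, `c ≠ 1` with `‖p‖⁻²‖c−1‖ < 1`): every
`a ∈ X` is `γ y − c y` for some `y ∈ X`. (The range contains the dense `S` by the finite-level statement
and is closed, `γ − c` being antilipschitz and uniformly continuous on the complete space `X`.)
[cite: Tate1967, §3.3 (proof of Theorem 2)] [cite: FontaineOuyang2022, §3.2 Prop. 3.17] -/
theorem exists_gen_smul_sub_mul_eq (hn : 2 ≤ n) {c : PadicBase F p hp} (hc1 : c ≠ 1)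
    (hsmall : ‖(p : PadicBase F p hp)‖⁻¹ ^ 2 * ‖c - 1‖ < 1) {a : CompletedAlgClosure F} (ha : a ∈ X hp) :
    ∃ y ∈ X hp, gen hp n • y - ι hp c * y = a := by
  -- the operator on the complete space `X`
  let T : X hp → X hp := fun y =>
    ⟨gen hp n • (y : CompletedAlgClosure F) - ι hp c * y, gen_smul_sub_mul_mem_X hp n c y.2⟩
  have hT : ∀ y : X hp, ((T y : X hp) : CompletedAlgClosure F) = gen hp n • (y : CompletedAlgClosure F) - ι hp c * y :=
    fun _ => rfl
  have hTsub : ∀ y y' : X hp, ((T y : X hp) : CompletedAlgClosure F) - (T y' : X hp) =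
      gen hp n • ((y : CompletedAlgClosure F) - y') - ι hp c * ((y : CompletedAlgClosure F) - y') := by
    intro y y'; rw [hT, hT, smul_sub, mul_sub]; abel
  haveI : CompleteSpace (X hp) := isClosed_closure.completeSpace_coe
  set C : ℝ := (‖(p : PadicBase F p hp)‖⁻¹ ^ 2 + ‖(p : PadicBase F p hp)‖⁻¹ / ‖c - 1‖) /
      (1 - ‖(p : PadicBase F p hp)‖⁻¹ ^ 2 * ‖c - 1‖) with hC
  have hP0 : 0 < ‖(p : PadicBase F p hp)‖⁻¹ := inv_pos.mpr (PadicBase.norm_p_pos hp)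
  have hd0 : 0 < ‖c - 1‖ := norm_pos_iff.mpr (sub_ne_zero.mpr hc1)
  have hC0 : 0 ≤ C :=
    div_nonneg (add_nonneg (sq_nonneg _) (div_nonneg hP0.le hd0.le)) (sub_pos.mpr hsmall).le
  -- antilipschitz (the a-priori bound) and uniformly continuous
  have hanti : AntilipschitzWith (Real.toNNReal C) T := by
    refine AntilipschitzWith.of_le_mul_dist fun y y' => ?_
    rw [Subtype.dist_eq, dist_eq_norm, Subtype.dist_eq, dist_eq_norm, Real.coe_toNNReal C hC0, hTsub]
    exact norm_le_mul_norm_gen_smul_sub_mul hp hn hc1 hsmall (sub_mem_X hp y.2 y'.2)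
  have hlip : LipschitzWith (1 + ‖c‖₊) T := by
    refine LipschitzWith.of_dist_le_mul fun y y' => ?_
    rw [Subtype.dist_eq, dist_eq_norm, Subtype.dist_eq, dist_eq_norm, hTsub, NNReal.coe_add, NNReal.coe_one,
      coe_nnnorm]
    refine (norm_sub_le _ _).trans ?_
    rw [CompletedAlgClosure.norm_base_smul, norm_mul, norm_ι, add_mul, one_mul]
  have hclosed : IsClosed (Set.range T) := hanti.isClosed_range hlip.uniformContinuous
  -- the range contains `S`, hence is dense
  have hS : Set.range (incl hp) ⊆ Set.range T := by
    rintro _ ⟨s, rfl⟩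
    obtain ⟨w, hw, hws⟩ := (mem_S_iff hp).mp s.2
    obtain ⟨M, hwM⟩ := (mem_Kinf_iff hp).mp hw
    obtain ⟨z, hzM, hz⟩ := exists_mem_K_gen_smul_sub_smul_eq hp hn hc1 hsmall hwM
    have hzS : ((z : NormedAlgClosure F) : CompletedAlgClosure F) ∈ S hp := coe_mem_S hp (K_le_Kinf hp M hzM)
    refine ⟨⟨(z : CompletedAlgClosure F), S_subset_X hp hzS⟩, Subtype.ext ?_⟩
    change gen hp n • ((z : NormedAlgClosure F) : CompletedAlgClosure F) - ι hp c * z = (s : CompletedAlgClosure F)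
    rw [CompletedAlgClosure.base_smul_coe, ← coe_base_smul, ← Completion.coe_sub, hz, hws]
  have hdense : Dense (Set.range T) := (denseRange_incl hp).mono hS
  have hrange : Set.range T = Set.univ := by rw [← hclosed.closure_eq, hdense.closure_eq]
  obtain ⟨y, hy⟩ : (⟨a, ha⟩ : X hp) ∈ Set.range T := by rw [hrange]; exact Set.mem_univ _
  exact ⟨(y : CompletedAlgClosure F), y.2, congrArg Subtype.val hy⟩

/-- **Tate: `γ − c` is bijective on `X`** (`n ≥ 2`, `c ∈ K₀`, `c ≠ 1`, `‖p‖⁻²‖c − 1‖ < 1`): every `a ∈ X` is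
`γ y − c y` for exactly one `y ∈ X`. [cite: Tate1967, §3.3 (proof of Theorem 2)] [cite: FontaineOuyang2022, §3.2 Prop. 3.17] -/
theorem exists_unique_gen_smul_sub_mul_eq (hn : 2 ≤ n) {c : PadicBase F p hp} (hc1 : c ≠ 1)
    (hsmall : ‖(p : PadicBase F p hp)‖⁻¹ ^ 2 * ‖c - 1‖ < 1) {a : CompletedAlgClosure F} (ha : a ∈ X hp) :
    ∃! y : CompletedAlgClosure F, y ∈ X hp ∧ gen hp n • y - ι hp c * y = a := by
  obtain ⟨y, hy, hya⟩ := exists_gen_smul_sub_mul_eq hp hn hc1 hsmall ha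
  refine ⟨y, ⟨hy, hya⟩, fun y' ⟨hy', hy'a⟩ => ?_⟩
  exact eq_of_gen_smul_sub_mul_eq hp hn hc1 hsmall hy' hy (hy'a.trans hya.symm)

/-! ### The cyclotomic twists `c = χ(γ)^{-j}` -/

/-- For `n ≥ 3` and any `j ∈ ℤ`, `c = χ(γ)^j` satisfies `‖p‖⁻² ‖c − 1‖ < 1` (`χ(γ) ≡ 1 mod pⁿ`). [cite: Tate1967, §3.3] -/
theorem norm_chi_gen_zpow_sub_one_small (hn : 3 ≤ n) (j : ℤ) :
    ‖(p : PadicBase F p hp)‖⁻¹ ^ 2 *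
        ‖(PadicBase.ofPadicInt hp (BaseGaloisGroup.baseCyclotomicCharacter hp (gen hp n) : ℤ_[p])) ^ j - 1‖ < 1 := by
  set w : PadicBase F p hp :=
    PadicBase.ofPadicInt hp (BaseGaloisGroup.baseCyclotomicCharacter hp (gen hp n) : ℤ_[p]) with hw
  have hw1 : ‖w‖ = 1 := PadicBase.norm_ofPadicInt_units hp _
  have hp0 := PadicBase.norm_p_pos hp
  have hp1 := PadicBase.norm_p_lt_one hp
  have hwsub : ‖w - 1‖ ≤ ‖(p : PadicBase F p hp)‖ ^ n := by
    rw [hw]; exact norm_chi_gen_sub_one_le hp (n := n) (by omega)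
  have hc : ‖w ^ j - 1‖ ≤ ‖(p : PadicBase F p hp)‖ ^ 3 :=
    (norm_zpow_sub_one_le_base hp hw1 hwsub j).trans (pow_le_pow_of_le_one hp0.le hp1.le hn)
  calc ‖(p : PadicBase F p hp)‖⁻¹ ^ 2 * ‖w ^ j - 1‖
      ≤ ‖(p : PadicBase F p hp)‖⁻¹ ^ 2 * ‖(p : PadicBase F p hp)‖ ^ 3 :=
        mul_le_mul_of_nonneg_left hc (pow_nonneg (inv_nonneg.mpr hp0.le) 2)
    _ = ‖(p : PadicBase F p hp)‖ := by field_simp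
    _ < 1 := hp1

/-- **Tate 1967 §3.3 Theorem 2 at the level of `X = \widehat{K_∞}`, both `H⁰` and `H¹`: for `j ≠ 0` and
`γ = gen n`, `n ≥ 3`, every `a ∈ X` is `χ(γ)^j · γ y − y` for a UNIQUE `y ∈ X`** (`χ(γ)^j ∈ K₀` acting
through `ι`). In cohomological terms, for the twisted action `γ ⋆ y = χ(γ)^j γ y` on `X(χ^j)` the map
`γ⋆ − 1` is bijective: `H⁰(⟨γ⟩, X(χ^j)) = 0` (the tree's `eq_zero_of_gen_smul_eq`) and no nonzero class
survives in `H¹`. Proof: `χ(γ)^j γ y − y = χ(γ)^j (γ y − χ(γ)^{-j} y)` and `γ − χ(γ)^{-j}` is bijective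
(`exists_unique_gen_smul_sub_mul_eq`, as `χ(γ)^{-j} ≠ 1` has `‖χ(γ)^{-j} − 1‖ ≤ ‖p‖ⁿ`).
[cite: Tate1967, §3.3 Theorem 2] [cite: FontaineOuyang2022, §3.2 Prop. 3.17 and Thm. 3.21] -/
theorem exists_unique_chi_zpow_mul_gen_smul_sub_eq (hn : 3 ≤ n) {j : ℤ} (hj : j ≠ 0)
    {a : CompletedAlgClosure F} (ha : a ∈ X hp) :
    ∃! y : CompletedAlgClosure F, y ∈ X hp ∧
      ι hp (PadicBase.ofPadicInt hp (BaseGaloisGroup.baseCyclotomicCharacter hp (gen hp n) : ℤ_[p])) ^ j *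
          (gen hp n • y) - y = a := by
  set w : PadicBase F p hp :=
    PadicBase.ofPadicInt hp (BaseGaloisGroup.baseCyclotomicCharacter hp (gen hp n) : ℤ_[p]) with hw
  have hw0 : w ≠ 0 := norm_pos_iff.mp (by rw [hw, PadicBase.norm_ofPadicInt_units]; exact one_pos)
  have hwj0 : ι hp w ^ j ≠ 0 := zpow_ne_zero j (by rw [Ne, ← norm_eq_zero, norm_ι, norm_eq_zero]; exact hw0)
  have hc1 : w ^ (-j) ≠ 1 := by
    rw [hw]; exact zpow_chi_gen_ne_one hp (n := n) (by omega) (neg_ne_zero.mpr hj)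
  have hsmall : ‖(p : PadicBase F p hp)‖⁻¹ ^ 2 * ‖w ^ (-j) - 1‖ < 1 := by
    rw [hw]; exact norm_chi_gen_zpow_sub_one_small hp hn (-j)
  -- the equation `w^j γy − y = a` is `γ y − w^{-j} y = w^{-j} a`
  have key : ∀ y : CompletedAlgClosure F,
      ι hp w ^ j * (gen hp n • y) - y = a ↔ gen hp n • y - ι hp (w ^ (-j)) * y = ι hp (w ^ (-j)) * a := by
    intro y
    rw [ι_zpow, zpow_neg]
    constructor
    · intro h
      rw [← h, mul_sub, ← mul_assoc, inv_mul_cancel₀ hwj0, one_mul]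
    · intro h
      have h2 := congrArg (fun z => ι hp w ^ j * z) h
      simp only [mul_sub, ← mul_assoc, mul_inv_cancel₀ hwj0, one_mul] at h2
      exact h2
  have ha' : ι hp (w ^ (-j)) * a ∈ X hp := ι_mul_mem_X hp _ ha
  obtain ⟨y, ⟨hy, hya⟩, huniq⟩ := exists_unique_gen_smul_sub_mul_eq hp (n := n) (by omega) hc1 hsmall ha'
  refine ⟨y, ⟨hy, (key y).mpr hya⟩, fun y' ⟨hy', hy'a⟩ => huniq y' ⟨hy', (key y').mp hy'a⟩⟩

end TateTrace

end Literature.NumberTheory.PAdicHodge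

end
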